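import Literature.AlgebraicGeometry.Smoothening.JacobianCriterion
import Literature.AlgebraicGeometry.Smoothening.JacobianLift
import Literature.AlgebraicGeometry.Smoothening.ConormalFibreKernel
import Literature.AlgebraicGeometry.Smoothening.KaehlerFibre
import Mathlib.RingTheory.Kaehler.TensorProduct
import Mathlib.RingTheory.Smooth.StandardSmoothCotangent
import HarnessLib

/-!
# The Jacobian criterion fibrewise: a smooth fibre of the expected dimension forces a non-vanishing minor

Topic: `Literature/AlgebraicGeometry/Smoothening`. Companion of `JacobianCriterion` (inverting a
`c × c` minor `Δ` of the Jacobian makes `D = R[T₁, …, Tₙ]/(f₁, …, f_c)` standard smooth of relative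
dimension `n - c`, Görtz–Wedhorn I Def. 6.14 / Stacks 00T6) and `JacobianLift` (relations with
independent differentials at a point). Here we prove the converse direction used to check
smoothness of a family from ONE fibre: if at a point of `Spec D` lying over a field-valued point
`R → k` of the base the FIBRE `k ⊗_R D` is smooth over `k` of the expected relative dimension
`n - c`, then some `c × c` minor of `(∂fⱼ/∂Tᵢ)` does not vanish at the point — so `D` is smooth
of relative dimension `n - c` over `R` near it (Hartshorne III Thm. 10.2: "`f` flat with smooth
fibres of dimension `n` ⇒ smooth"; in the Jacobian form no flatness hypothesis is needed, the
number of equations being the expected one). Everything is proved; no named facts (D-0026).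

* `conormalSpan_span_range_eq` — at a point of `Spec D` the conormal span
  (`ConormalFibreKernel.conormalSpan`) of `(f₁, …, f_c)` is spanned by `1 ⊗ df₁, …, 1 ⊗ df_c`;
* `linearIndependent_tmul_D`, `exists_jacobianMinor_ne_zero_of_finrank_conormalSpan` — if that
  span has dimension `c`, the `1 ⊗ dfⱼ` are independent and some minor `Δ` is non-zero at the point
  (`JacobianLift.exists_submatrix_det_ne_zero_of_linearIndependent`);
* `finrank_conormalSpan_eq` — the span has dimension `c` as soon as `dim (L ⊗_D Ω[D⁄R]) = n - c`
  (conormal sequence at the point, `ConormalFibreKernel.finrank_conormalSpan_add`);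
* `finrank_tensor_kaehler_eq_of_away` — at a point of a `k`-algebra locally standard smooth of
  relative dimension `d`, `dim (L ⊗ Ω) = d` (differentials commute with localisation,
  `KaehlerFibre.fibreMap_bijective_of_isLocalization`; `Ω` of a standard smooth algebra is free of
  rank `d`, Mathlib `IsStandardSmoothOfRelativeDimension.rank_kaehlerDifferential`);
* `tensorKaehlerFibreEquiv` — `L ⊗_D Ω[D⁄R] ≃ L ⊗_F Ω[F⁄k]` for the fibre `F = k ⊗_R D` (Mathlib
  `KaehlerDifferential.tensorKaehlerEquiv`);
* `exists_algebraMap_jacobianMinor_ne_zero_of_fibre` — **the fibrewise Jacobian criterion**.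

## References

* U. Görtz, T. Wedhorn, *Algebraic Geometry I: Schemes*, 2nd ed. (2020), Def. 6.14 (p. 159).
  [GortzWedhorn2020]
* The Stacks project, Tag 00T6 (standard smooth algebras), Tag 01V9. [StacksProject]
* R. Hartshorne, *Algebraic Geometry* (1977), III Thm. 10.2. [Hartshorne1977]
-/

noncomputable section

open scoped TensorProduct
open MvPolynomial KaehlerDifferential

namespace Literature.AlgebraicGeometry.Smoothening

universe u

/-! ### The differentials of the relations at a point -/

section Generators

variable {R : Type u} [CommRing R] {n c : ℕ} (f : Fin c → MvPolynomial (Fin n) R)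
  (L : Type u) [Field L] [Algebra (MvPolynomial (Fin n) R) L] [Algebra (Quot f) L]
  [IsScalarTower (MvPolynomial (Fin n) R) (Quot f) L]

/-- The relations vanish at every point of `Spec R[T]/(f)`. [folklore] -/
theorem algebraMap_relation_eq_zero (i : Fin c) : algebraMap (MvPolynomial (Fin n) R) L (f i) = 0 := by
  rw [IsScalarTower.algebraMap_apply (MvPolynomial (Fin n) R) (Quot f) L,
    show algebraMap (MvPolynomial (Fin n) R) (Quot f) (f i) = 0 from
      Ideal.Quotient.eq_zero_iff_mem.2 (Ideal.subset_span ⟨i, rfl⟩), map_zero]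

/-- **The conormal span is spanned by the differentials of the chosen relations**: at an
`L`-valued point of `Spec R[T₁, …, Tₙ]/(f₁, …, f_c)`, the `L`-span of the `1 ⊗ dg`, `g ∈ (f)`, is
the span of `1 ⊗ df₁, …, 1 ⊗ df_c` (Leibniz: `d(Σ λᵢ fᵢ) = Σ λᵢ dfᵢ + fᵢ dλᵢ` and `fᵢ = 0` at the
point). [folklore] -/
theorem conormalSpan_span_range_eq :
    conormalSpan R (MvPolynomial (Fin n) R) (Ideal.span (Set.range f)) L =
      Submodule.span L (Set.range fun i ↦
        (1 : L) ⊗ₜ[MvPolynomial (Fin n) R] D R (MvPolynomial (Fin n) R) (f i)) := by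
  apply le_antisymm
  · rw [conormalSpan, Submodule.span_le]
    rintro _ ⟨⟨g, hg⟩, rfl⟩
    obtain ⟨coef, rfl⟩ := Ideal.mem_span_range_iff_exists_fun.1 hg
    simp only [map_sum, TensorProduct.tmul_sum]
    refine Submodule.sum_mem _ fun i _ ↦ ?_
    rw [Derivation.leibniz, TensorProduct.tmul_add, TensorProduct.tmul_smul, TensorProduct.tmul_smul,
      ← IsScalarTower.algebraMap_smul L (coef i), ← IsScalarTower.algebraMap_smul L (f i),
      algebraMap_relation_eq_zero f L i, zero_smul, add_zero]
    exact Submodule.smul_mem _ _ (Submodule.subset_span ⟨i, rfl⟩)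
  · rw [Submodule.span_le]
    rintro _ ⟨i, rfl⟩
    exact tmul_D_mem_conormalSpan R (MvPolynomial (Fin n) R) (Ideal.span (Set.range f)) L
      (Ideal.subset_span ⟨i, rfl⟩)

/-- **If the conormal span has dimension `c`, the differentials of the `c` relations are linearly
independent at the point** (`c` spanning vectors of a `c`-dimensional space). [folklore] -/
theorem linearIndependent_tmul_D
    (hc : Module.finrank L
      (conormalSpan R (MvPolynomial (Fin n) R) (Ideal.span (Set.range f)) L) = c) :
    LinearIndependent L fun i ↦
      (1 : L) ⊗ₜ[MvPolynomial (Fin n) R] D R (MvPolynomial (Fin n) R) (f i) := by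
  rw [linearIndependent_iff_card_eq_finrank_span, Fintype.card_fin, Set.finrank,
    ← conormalSpan_span_range_eq, hc]

/-- **Some Jacobian minor does not vanish at the point** if the conormal span of the relations
has dimension `c` there: the rows `(∂fᵢ/∂Tⱼ)(x)` are the coordinates of the independent vectors
`1 ⊗ dfᵢ` in the basis `1 ⊗ dTⱼ`. [cite: GortzWedhorn2020, Def. 6.14 (p. 159)] -/
theorem exists_jacobianMinor_ne_zero_of_finrank_conormalSpan
    (hc : Module.finrank L
      (conormalSpan R (MvPolynomial (Fin n) R) (Ideal.span (Set.range f)) L) = c) :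
    ∃ (a : Fin c → Fin n) (ha : Function.Injective a),
      algebraMap (Quot f) L (jacobianMinor f a ha) ≠ 0 := by
  classical
  set w : Fin c → L ⊗[MvPolynomial (Fin n) R] Ω[MvPolynomial (Fin n) R⁄R] :=
    fun i ↦ (1 : L) ⊗ₜ[MvPolynomial (Fin n) R] D R (MvPolynomial (Fin n) R) (f i) with hw
  have hwli : LinearIndependent L w := linearIndependent_tmul_D f L hc
  let M : Matrix (Fin c) (Fin n) L :=
    Matrix.of fun i j ↦ algebraMap (MvPolynomial (Fin n) R) L (pderiv j (f i))
  have hrow : M.row = fun i ↦ ⇑((tensorKaehlerBasis L).repr (w i)) := by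
    funext i j
    change algebraMap (MvPolynomial (Fin n) R) L (pderiv j (f i)) = (tensorKaehlerBasis L).repr (w i) j
    rw [hw, repr_tmul_D]
  have hMli : LinearIndependent L M.row := by
    rw [hrow]
    have h1 : LinearIndependent L (fun i ↦ ((tensorKaehlerBasis L).repr (w i) : Fin n →₀ L)) :=
      hwli.map' (tensorKaehlerBasis L).repr.toLinearMap (tensorKaehlerBasis L).repr.ker
    exact h1.map' (Finsupp.linearEquivFunOnFinite L L (Fin n)).toLinearMap
      (Finsupp.linearEquivFunOnFinite L L (Fin n)).ker
  obtain ⟨a, ha, hdet⟩ := exists_submatrix_det_ne_zero_of_linearIndependent M hMli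
  refine ⟨a, ha, ?_⟩
  rw [jacobianMinor_eq_mk_det, ← Ideal.Quotient.algebraMap_eq, ← IsScalarTower.algebraMap_apply,
    RingHom.map_det]
  have hN : (algebraMap (MvPolynomial (Fin n) R) L).mapMatrix
      (Matrix.of fun i j ↦ (f j).pderiv (a i)) = (M.submatrix id a).transpose := by
    ext i j
    rfl
  rw [hN, Matrix.det_transpose]
  exact hdet

/-- **Dimension count**: if the differentials of `T = R[T₁, …, Tₙ]/(f₁, …, f_c)` at the point have
dimension `n - c` (the expected relative dimension) and `c ≤ n`, the conormal span has dimension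
`c` (conormal sequence base-changed to the point: `rank conormalSpan + rank (L ⊗ Ω[T⁄R]) = n`).
[folklore] -/
theorem finrank_conormalSpan_eq [Algebra R L] [IsScalarTower R (MvPolynomial (Fin n) R) L]
    [IsScalarTower R (Quot f) L]
    (h : Module.finrank L (L ⊗[Quot f] Ω[Quot f⁄R]) = n - c) (hcn : c ≤ n) :
    Module.finrank L (conormalSpan R (MvPolynomial (Fin n) R) (Ideal.span (Set.range f)) L) = c := by
  haveI : Module.Finite (MvPolynomial (Fin n) R) Ω[MvPolynomial (Fin n) R⁄R] :=
    Module.Finite.of_basis (KaehlerDifferential.mvPolynomialBasis R (Fin n))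
  have key := finrank_conormalSpan_add R (MvPolynomial (Fin n) R) (Ideal.span (Set.range f)) L
  have hn : Module.finrank L (L ⊗[MvPolynomial (Fin n) R] Ω[MvPolynomial (Fin n) R⁄R]) = n := by
    rw [Module.finrank_eq_card_basis (tensorKaehlerBasis L), Fintype.card_fin]
  rw [hn] at key
  change Module.finrank L (conormalSpan R (MvPolynomial (Fin n) R) (Ideal.span (Set.range f)) L) +
    Module.finrank L (L ⊗[Quot f] Ω[Quot f⁄R]) = n at key
  omega

end Generators

/-! ### The differentials at a point of a smooth fibre -/

section FibreRank

variable {k : Type u} [Field k] {F : Type u} [CommRing F] [Algebra k F]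
  (L : Type u) [Field L] [Algebra F L]

/-- **At a point of an algebra locally standard smooth of relative dimension `d`, the
differentials have dimension `d`**: if `s ∈ F` does not vanish at the `L`-valued point and
`F[1/s]` is standard smooth of relative dimension `d` over the field `k`, then
`dim_L (L ⊗_F Ω[F⁄k]) = d` (differentials commute with localisation, and `Ω[F[1/s]⁄k]` is free of
rank `d`). [cite: StacksProject, Tag 00T6] -/
theorem finrank_tensor_kaehler_eq_of_away (d : ℕ) (s : F) (hs : algebraMap F L s ≠ 0)
    [Algebra.IsStandardSmoothOfRelativeDimension d k (Localization.Away s)] :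
    Module.finrank L (L ⊗[F] Ω[F⁄k]) = d := by
  have hunit : IsUnit (algebraMap F L s) := isUnit_iff_ne_zero.2 hs
  letI : Algebra (Localization.Away s) L := (IsLocalization.Away.lift s hunit).toAlgebra
  have halg : ∀ x : F, algebraMap (Localization.Away s) L (algebraMap F (Localization.Away s) x) =
      algebraMap F L x := fun x ↦ IsLocalization.Away.lift_eq s hunit x
  haveI : IsScalarTower F (Localization.Away s) L := IsScalarTower.of_algebraMap_eq fun x ↦ (halg x).symm
  have hbij := fibreMap_bijective_of_isLocalization k F (Localization.Away s) L (Submonoid.powers s)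
  rw [(LinearEquiv.ofBijective _ hbij).finrank_eq]
  -- `Ω[F[1/s]⁄k]` is free of rank `d`
  haveI : Nontrivial (Localization.Away s) := (algebraMap (Localization.Away s) L).domain_nontrivial
  haveI : Algebra.IsStandardSmooth k (Localization.Away s) :=
    Algebra.IsStandardSmoothOfRelativeDimension.isStandardSmooth d
  haveI : Module.Free (Localization.Away s) Ω[Localization.Away s⁄k] := inferInstance
  have hrank : Module.finrank (Localization.Away s) Ω[Localization.Away s⁄k] = d :=
    Module.finrank_eq_of_rank_eq
      (Algebra.IsStandardSmoothOfRelativeDimension.rank_kaehlerDifferential (R := k) d)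
  set b := Module.Free.chooseBasis (Localization.Away s) Ω[Localization.Away s⁄k] with hb
  haveI : Fintype (Module.Free.ChooseBasisIndex (Localization.Away s) Ω[Localization.Away s⁄k]) := by
    refine @Fintype.ofFinite _ (Module.Finite.finite_basis b)
  rw [Module.finrank_eq_card_basis (Algebra.TensorProduct.basis L b), ← hrank,
    Module.finrank_eq_card_basis b]

end FibreRank

/-! ### Base change to the fibre -/

section BaseChange

variable (R : Type u) [CommRing R] (T : Type u) [CommRing T] [Algebra R T]
  (k : Type u) [Field k] [Algebra R k]
  (F : Type u) [CommRing F] [Algebra k F] [Algebra T F] [Algebra R F] [IsScalarTower R k F]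
  [IsScalarTower R T F] [Algebra.IsPushout R k T F]
  (L : Type u) [Field L] [Algebra F L] [Algebra T L] [IsScalarTower T F L]

/-- **The differentials at a point of the fibre are the relative differentials at that point**:
for an `R`-algebra `T`, a point `R → k` with fibre `F = k ⊗_R T` (any pushout) and an `L`-valued
point of `F`, `L ⊗_T Ω[T⁄R] ≃ L ⊗_F Ω[F⁄k]` (Kähler differentials commute with base change,
Mathlib `KaehlerDifferential.tensorKaehlerEquiv`). [folklore] -/
def tensorKaehlerFibreEquiv : L ⊗[T] Ω[T⁄R] ≃ₗ[L] L ⊗[F] Ω[F⁄k] :=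
  (TensorProduct.AlgebraTensorModule.cancelBaseChange T F L L Ω[T⁄R]).symm ≪≫ₗ
    TensorProduct.AlgebraTensorModule.congr (LinearEquiv.refl L L)
      (KaehlerDifferential.tensorKaehlerEquiv R k T F)

/-- Hence `dim_L (L ⊗_T Ω[T⁄R]) = dim_L (L ⊗_F Ω[F⁄k])`. [folklore] -/
theorem finrank_tensor_kaehler_eq_fibre :
    Module.finrank L (L ⊗[T] Ω[T⁄R]) = Module.finrank L (L ⊗[F] Ω[F⁄k]) :=
  (tensorKaehlerFibreEquiv R T k F L).finrank_eq

end BaseChange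

/-! ### The fibrewise Jacobian criterion -/

section Main

variable {R : Type u} [CommRing R] {n c : ℕ} (f : Fin c → MvPolynomial (Fin n) R)
  (k : Type u) [Field k] [Algebra R k]
  (F : Type u) [CommRing F] [Algebra k F] [Algebra (Quot f) F] [Algebra R F] [IsScalarTower R k F]
  [IsScalarTower R (Quot f) F] [Algebra.IsPushout R k (Quot f) F]
  (L : Type u) [Field L] [Algebra F L] [Algebra (Quot f) L] [IsScalarTower (Quot f) F L]
  [Algebra (MvPolynomial (Fin n) R) L] [IsScalarTower (MvPolynomial (Fin n) R) (Quot f) L]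
  [Algebra R L] [IsScalarTower R (MvPolynomial (Fin n) R) L] [IsScalarTower R (Quot f) L]

/-- **The Jacobian criterion, fibrewise** (Görtz–Wedhorn I Def. 6.14 / Stacks 00T6 in the form
used here): let `T = R[T₁, …, Tₙ]/(f₁, …, f_c)` with `c ≤ n`, let `R → k` be a point of `Spec R`
with values in a field and `F = k ⊗_R T` the fibre (any pushout), and let `L` be a field-valued
point of `F` at which the fibre is smooth over `k` of the expected relative dimension `n - c`
(some `s ∈ F` not vanishing at the point with `F[1/s]` standard smooth of relative dimension
`n - c` over `k`). Then some `c × c` minor `Δ` of the Jacobian `(∂fⱼ/∂Tᵢ)` does not vanish at the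
point; consequently `T` is smooth of relative dimension `n - c` over `R` on `D(Δ) ∋` the point
(`isStandardSmoothOfRelativeDimension_away`). Proof: `dim (L ⊗ Ω[T⁄R]) = dim (L ⊗ Ω[F⁄k]) = n - c`,
so the conormal span at the point has dimension `c` and is spanned by the independent `1 ⊗ dfⱼ`.
[cite: GortzWedhorn2020, Def. 6.14 (p. 159)] [cite: StacksProject, Tag 00T6] -/
theorem exists_algebraMap_jacobianMinor_ne_zero_of_fibre (hcn : c ≤ n) (s : F)
    (hs : algebraMap F L s ≠ 0)
    [Algebra.IsStandardSmoothOfRelativeDimension (n - c) k (Localization.Away s)] :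
    ∃ (a : Fin c → Fin n) (ha : Function.Injective a),
      algebraMap (Quot f) L (jacobianMinor f a ha) ≠ 0 := by
  have hd : Module.finrank L (L ⊗[Quot f] Ω[Quot f⁄R]) = n - c := by
    rw [finrank_tensor_kaehler_eq_fibre R (Quot f) k F L]
    exact finrank_tensor_kaehler_eq_of_away L (n - c) s hs
  exact exists_jacobianMinor_ne_zero_of_finrank_conormalSpan f L
    (finrank_conormalSpan_eq f L hd hcn)

end Main

end Literature.AlgebraicGeometry.Smoothening

end
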